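import Summits.BirchSwinnertonDyer.BirchSwinnertonDyer.Theorems.ErratumRoadFiveEulerHalfGenusFrameSupplySign
import Summits.BirchSwinnertonDyer.Rank1Residual.Additive.RamifiedTwistConductor
import HarnessLib

/-!
# Route `ErratumRoadFive` (K2), crux `EulerHalfNotRamNoInertSetAtFive` (stmt-BirchSwinnertonDyer-19715), crux idea
# `ramified-twin-ram-transport` — the ramified-twist SIGN LAW at an additive potentially multiplicative prime,
# for EVERY ODD prime `p` (the `p = 3` corner of the genus-frame field supply, TURNKEY §8 S1)

Cell `bsd-stepL`, width seat `bsd-line-er5-p1-w5` (g5). THEOREMS ONLY; no definition, no named fact, no `sorry`.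
Helper `--supports stmt-BirchSwinnertonDyer-19715`; it closes nothing by itself.

WHY. The tree's ramified sign laws at an additive potentially multiplicative prime `p`
(`ThreeFieldRoadSupply.rootNumber_mul_rootNumber_ramifiedTwist_of_mult_model`, its real twin
`EulerHalfGenusSupply.rootNumber_mul_rootNumber_realRamifiedTwist_of_mult_model`, and the supplies built on them:
`EulerHalfGenusFrame.genusFrameTwistSupply_of_hoffsteinLuo`, p667834) carry `5 ≤ p`. First-hand reading of the chain
shows the bound enters at exactly two places: (i) `f_p(E) = 2` (`conductorNorm_eq_mul_sq_of_addv` ⟸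
`condExpTwo_of_addv_of_five_le`, Tate's algorithm at `p ≥ 5`), and (ii) `conductorNorm_pStarTwist_eq_mul_of_mult`,
whose proof uses `5 ≤ p` only as `p ≠ 2`. On the POTENTIALLY MULTIPLICATIVE row (i) holds at every odd `p`: the
tree theorem `Additive.condExpTwo_of_twist_pm_p` (Ogg's formula, tame case in odd residue characteristic — «valid
for `ℓ = 3`», from `kodairaSymbolAt_twist_of_semistable`) gives `f_p(W) = 2` for `W ≅ V^{(±p)}` with `V`
multiplicative at `p`. Everything else in the chain (the modular identity
`rootNumber_mul_rootNumber_pStarTwist_eq_legendreSym_mul_χ₄_mul_of_mult`, `λ_p(f') = W_p` at `p ∥ N'`, the coprime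
twisting law, the Jacobi bookkeeping) is already stated for `p ≠ 2`.

CONTENT (namespace `…Theorems.EulerHalfGenusSupply`; `p` odd throughout; `W`, `V` globally minimal where Ogg is used):
* `conductorNorm_eq_mul_sq_of_condExpTwo` — `N_E = M p²`, `p ∤ M` from `f_p(E) = 2`;
* `condExpTwo_of_pStarTwistModel` — `f_p(W) = 2` for `C • W^{(p*)} = V`, `V` multiplicative at `p`;
* `conductorNorm_pStarTwist_eq_mul_of_mult_odd` — `N_{E^{(p*)}} = M p` (verbatim, `p ≠ 2`);
* `rootNumber_mul_rootNumber_pStarTwist_of_multTwist_odd` — `w(E)·w(E^{(p*)}) = (M/p)·χ₄(p)·W_p(E^{(p*)})`;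
* `rootNumber_mul_rootNumber_ramifiedTwist_signFree_of_multTwist_odd` —
  `w(E)·w(E^{(p*d')}) = (−1/|d'|)·χ₄(p)·(d'/p)·W_p(E^{(p*)})`, BOTH signs of `p*d'` at once;
* `rootNumber_mul_rootNumber_realRamifiedTwist_of_mult_model_odd` (`p*d' > 0`: `+(d'/p)·W_p(V)`) and
  `rootNumber_mul_rootNumber_ramifiedTwist_of_mult_model_odd` (`p*d' < 0`: `−(d'/p)·W_p(V)`), `W_p(V) = −1` iff split.

References: [Rohrlich1993Compositio] Prop. 2(ii),(iii); [AtkinLehner1970] §6; [KellockDokchitser2023] Rem. 2.2;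
[MurtyMurty1997] Ch. 6 §1; [SilvermanATAEC1994] IV.10.4, IV.11.1. Axioms: `propext`, `Classical.choice`, `Quot.sound`.
No summit statement is proved here; BSD is proved for no curve.
-/

set_option autoImplicit false
-- D-0017: single-problem summit, so `Summit.BirchSwinnertonDyer.BirchSwinnertonDyer.…` repeats a namespace BY DESIGN.
set_option linter.dupNamespace false

noncomputable section

open scoped Classical NumberTheorySymbols

open IsDedekindDomain IsDedekindDomain.HeightOneSpectrum NumberField Rat.HeightOneSpectrum
  WeierstrassCurve Literature.NumberTheory.EllipticCurves Literature.NumberTheory.EllipticCurves.ModularForms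
  Literature.NumberTheory.EllipticCurves.Rank1Residual
  Summit.BirchSwinnertonDyer.Rank1Residual Summit.BirchSwinnertonDyer.Rank1Residual.Additive
  Summit.BirchSwinnertonDyer.BirchSwinnertonDyer.Theorems.AdditiveKoly.RamifiedHabitat
  Summit.BirchSwinnertonDyer.BirchSwinnertonDyer.Theorems.ThreeFieldRoadSupply

namespace Summit.BirchSwinnertonDyer.BirchSwinnertonDyer.Theorems.EulerHalfGenusSupply

section SignOdd

variable (W : WeierstrassCurve ℚ) [W.IsElliptic] (p : ℕ) [hp : Fact p.Prime]

/-- **`N_E = M·p²` with `p ∤ M` from `f_p(E) = 2`** (`CondExpTwo W p`); the proof of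
`ThreeFieldRoadSupply.conductorNorm_eq_mul_sq_of_addv` from its second line on.
[cite: SilvermanATAEC1994, IV.10.2(b) and IV.10.4] -/
theorem conductorNorm_eq_mul_sq_of_condExpTwo (h2 : CondExpTwo W p) :
    ∃ M : ℕ, W.conductorNorm ℤ = M * p ^ 2 ∧ ¬ p ∣ M := by
  have hf : (W.conductorNorm ℤ).factorization (natGenerator (placeOf p)) =
      W.conductorExponent (placeOf p) :=
    WeierstrassCurve.factorization_conductorNorm_holds W (placeOf p)
  have hgen : natGenerator (placeOf p) = p :=
    congrArg Subtype.val ((primesEquiv (R := ℤ)).apply_symm_apply ⟨p, hp.out⟩)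
  rw [hgen] at hf
  unfold CondExpTwo condExp at h2
  rw [h2] at hf
  have hN0 : W.conductorNorm ℤ ≠ 0 := (W.conductorNorm_pos_holds).ne'
  have hdvd : p ^ 2 ∣ W.conductorNorm ℤ := by
    rw [← hf]; exact Nat.ordProj_dvd (W.conductorNorm ℤ) p
  have hndvd : ¬ p ^ 3 ∣ W.conductorNorm ℤ := by
    rw [show 3 = (W.conductorNorm ℤ).factorization p + 1 by rw [hf]]
    exact Nat.pow_succ_factorization_not_dvd hN0 hp.out
  obtain ⟨M, hM⟩ := hdvd
  refine ⟨M, by rw [hM, mul_comm], fun hk ↦ hndvd ?_⟩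
  obtain ⟨k, hk⟩ := hk
  exact ⟨k, by rw [hM, hk]; ring⟩

/-- **`f_p(W) = 2` at an odd additive potentially multiplicative `p`, from the multiplicative twist model**:
for globally minimal `W`, `V` with `C • W^{(p*)} = V` and `V` multiplicative at `p`, `W ≅ V^{(p*)}` (`p* = ±p`), so
Ogg's tame formula (`Additive.condExpTwo_of_twist_pm_p`, valid at `p = 3`) applies.
[cite: SilvermanATAEC1994, IV.10.4 and proof of IV.11.1 for p = 3] -/
theorem condExpTwo_of_pStarTwistModel [W.IsGloballyMinimal] (hp2 : p ≠ 2)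
    (V : WeierstrassCurve ℚ) [V.IsElliptic] [V.IsGloballyMinimal] (C : VariableChange ℚ)
    (hV : C • W.quadraticTwist ((-1 : ℚ) ^ (p / 2) * p) = V) (hmultV : Mult V p) : CondExpTwo W p := by
  set ps : ℚ := (-1 : ℚ) ^ (p / 2) * p with hps
  have hps0 : ps ≠ 0 := mul_ne_zero (pow_ne_zero _ (by norm_num)) (Nat.cast_ne_zero.mpr hp.out.ne_zero)
  haveI := W.isElliptic_quadraticTwist hps0
  -- `V^{(p*)} = (C • W^{(p*)})^{(p*)} = C' • W^{(p*·p*)}` and `W^{(1·p*²)} ≅ W^{(1)} ≅ W`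
  obtain ⟨C₂, hC₂⟩ := W.exists_variableChange_quadraticTwist_mul_sq 1 ps hps0
  obtain ⟨C₀, hC₀⟩ := W.exists_variableChange_quadraticTwist_one
  have hW : V.quadraticTwist ps = ((⟨C.u, ps * C.r, 0, 0⟩ : VariableChange ℚ) * C₂ * C₀) • W := by
    rw [← hV, WeierstrassCurve.quadraticTwist_smul, quadraticTwist_quadraticTwist, mul_smul, mul_smul, hC₀, hC₂,
      one_mul, sq]
  have hd : ps = p ∨ ps = -p := by
    rcases neg_one_pow_eq_or ℚ (p / 2) with h | h
    · left; rw [hps, h, one_mul]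
    · right; rw [hps, h]; ring
  exact condExpTwo_of_twist_pm_p p hp2 V (Or.inr hmultV) hd ((⟨C.u, ps * C.r, 0, 0⟩ : VariableChange ℚ) * C₂ * C₀)⁻¹
    (by rw [hW, inv_smul_smul])

/-- **`N_{E^{(p*)}}·p = N_E` when `E^{(p*)}` is MULTIPLICATIVE at the odd prime `p` and `N_E = M p²`** (`f_p(E') = 1`; away from
`p` the twist is by `p* ≡ 1 (mod 4)`, prime to the level): `RamifiedHabitat.conductorNorm_pStarTwist_eq_mul_of_mult` verbatim
with `5 ≤ p` weakened to `p ≠ 2` (its proof used nothing else). [cite: Silverman1994, IV.10.2 and IV.10.4] -/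
theorem conductorNorm_pStarTwist_eq_mul_of_mult_odd (hp2 : p ≠ 2)
    [(W.quadraticTwist (((-1 : ℤ) ^ (p / 2) * p : ℤ) : ℚ)).IsElliptic] {M : ℕ} (hN : W.conductorNorm ℤ = M * p ^ 2)
    (hpM : ¬ p ∣ M) (hmult : (W.quadraticTwist (((-1 : ℤ) ^ (p / 2) * p : ℤ) : ℚ)).HasMultiplicativeReductionAtPrime p) :
    (W.quadraticTwist (((-1 : ℤ) ^ (p / 2) * p : ℤ) : ℚ)).conductorNorm ℤ = M * p := by
  -- adapted from `RamifiedHabitat.conductorNorm_pStarTwist_eq_mul_of_mult` (`hp5` only fed `hp2` there)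
  have hp' : p.Prime := hp.out
  set N' := (W.quadraticTwist (((-1 : ℤ) ^ (p / 2) * p : ℤ) : ℚ)).conductorNorm ℤ with hN'
  have hN'0 : N' ≠ 0 := ((W.quadraticTwist _).conductorNorm_pos_holds).ne'
  have hM0 : M ≠ 0 := fun h ↦ (W.conductorNorm_pos_holds).ne' (by rw [hN, h, zero_mul])
  have hgen : ∀ q : Nat.Primes, natGenerator ((primesEquiv (R := ℤ)).symm q) = q := fun q ↦
    congrArg (fun q : Nat.Primes ↦ (q : ℕ)) ((primesEquiv (R := ℤ)).apply_symm_apply q)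
  refine Nat.eq_of_factorization_eq hN'0 (mul_ne_zero hM0 hp'.ne_zero) fun q ↦ ?_
  by_cases hq : q.Prime
  swap
  · rw [Nat.factorization_eq_zero_of_not_prime _ hq, Nat.factorization_eq_zero_of_not_prime _ hq]
  set vq : HeightOneSpectrum ℤ := (primesEquiv (R := ℤ)).symm ⟨q, hq⟩ with hvq
  have hgenq : natGenerator vq = q := by rw [hvq]; exact hgen ⟨q, hq⟩
  by_cases hqp : q = p
  · subst hqp
    have hmult' : (W.quadraticTwist (((-1 : ℤ) ^ (q / 2) * q : ℤ) : ℚ)).HasMultiplicativeReductionAt vq :=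
      ((W.quadraticTwist _).hasMultiplicativeReductionAtPrime_iff_hasMultiplicativeReductionAt_holds ⟨q, hq⟩).mp hmult
    have h1 := ((conductorExponent_eq_one_iff_holds vq (W.quadraticTwist (((-1 : ℤ) ^ (q / 2) * q : ℤ) : ℚ))).mpr hmult')
    have hf := factorization_conductorNorm_holds (W.quadraticTwist (((-1 : ℤ) ^ (q / 2) * q : ℤ) : ℚ)) vq
    rw [hgenq] at hf
    rw [hf, h1, Nat.factorization_mul hM0 hq.ne_zero, Finsupp.add_apply, hq.factorization, Finsupp.single_eq_same,
      Nat.factorization_eq_zero_of_not_dvd hpM]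
  · have hqd : ¬ ((natGenerator vq : ℕ) : ℤ) ∣ (-1 : ℤ) ^ (p / 2) * p := by
      rw [hgenq]; exact fun h ↦ hqp (eq_of_prime_dvd_pStar hq h)
    have h := W.factorization_conductorNorm_quadraticTwist_eq_of_not_dvd (pStar_emod_four hp2) vq hqd
    rw [hgenq] at h
    rw [h, hN, Nat.factorization_mul hM0 (pow_ne_zero 2 hp'.ne_zero), Nat.factorization_mul hM0 hp'.ne_zero, Finsupp.add_apply,
      Finsupp.add_apply, Nat.factorization_pow, Finsupp.smul_apply, hp'.factorization, Finsupp.single_eq_of_ne hqp, smul_zero]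

/-- **`w(E)·w(E^{(p*)}) = (M/p)·(−1/p)·W_p(E^{(p*)})` at an ODD `p` with `E^{(p*)}` MULTIPLICATIVE at `p`**, `N_E = M p²`, `p ∤ M`,
assuming only the Modularity Theorem: `ThreeFieldRoadSupply.rootNumber_mul_rootNumber_pStarTwist_of_multTwist` verbatim with
`5 ≤ p` weakened to `p ≠ 2`. [cite: AtkinLehner1970, §6] [cite: KellockDokchitser2023, Rem. 2.2 and Thm. 2.3] -/
theorem rootNumber_mul_rootNumber_pStarTwist_of_multTwist_odd (hmod : exists_isNewformOf) (hp2 : p ≠ 2)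
    {M : ℕ} (hN : W.conductorNorm ℤ = M * p ^ 2) (hpM : ¬ p ∣ M)
    (hmult : (W.quadraticTwist (((-1 : ℤ) ^ (p / 2) * p : ℤ) : ℚ)).HasMultiplicativeReductionAtPrime p) :
    W.rootNumber * (W.quadraticTwist (((-1 : ℤ) ^ (p / 2) * p : ℤ) : ℚ)).rootNumber =
      legendreSym p M * ZMod.χ₄ p *
        ((W.quadraticTwist (((-1 : ℤ) ^ (p / 2) * p : ℤ) : ℚ)).baseChange ℚ_[p]).localRootNumber ℤ_[p] := by
  -- adapted from `ThreeFieldRoadSupply.rootNumber_mul_rootNumber_pStarTwist_of_multTwist`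
  have hp' : p.Prime := hp.out
  have hdZ0 : ((-1 : ℤ) ^ (p / 2) * p : ℤ) ≠ 0 :=
    mul_ne_zero (pow_ne_zero _ (by norm_num)) (by exact_mod_cast hp'.ne_zero)
  have hd0 : (((((-1 : ℤ) ^ (p / 2) * p : ℤ)) : ℚ)) ≠ 0 := by exact_mod_cast hdZ0
  haveI hE' : (W.quadraticTwist (((-1 : ℤ) ^ (p / 2) * p : ℤ) : ℚ)).IsElliptic :=
    W.isElliptic_quadraticTwist hd0
  haveI : NeZero (W.conductorNorm ℤ) := ⟨(W.conductorNorm_pos_holds).ne'⟩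
  haveI : NeZero ((W.quadraticTwist (((-1 : ℤ) ^ (p / 2) * p : ℤ) : ℚ)).conductorNorm ℤ) :=
    ⟨((W.quadraticTwist _).conductorNorm_pos_holds).ne'⟩
  have hN' := conductorNorm_pStarTwist_eq_mul_of_mult_odd W p hp2 hN hpM hmult
  obtain ⟨f, hf⟩ := hmod W
  obtain ⟨f', hf'⟩ := hmod (W.quadraticTwist (((-1 : ℤ) ^ (p / 2) * p : ℤ) : ℚ))
  have h0 := rootNumber_mul_rootNumber_pStarTwist_eq_legendreSym_mul_χ₄_mul_of_mult W hp2 hN hpM hN' hf hf'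
  set P : Nat.Primes := ⟨p, hp'⟩ with hP
  have hPN' : (P : ℕ) ∣ (W.quadraticTwist (((-1 : ℤ) ^ (p / 2) * p : ℤ) : ℚ)).conductorNorm ℤ := by
    change p ∣ _; rw [hN']; exact ⟨M, by ring⟩
  have hPN'2 : ¬ (P : ℕ) ^ 2 ∣ (W.quadraticTwist (((-1 : ℤ) ^ (p / 2) * p : ℤ) : ℚ)).conductorNorm ℤ := by
    change ¬ p ^ 2 ∣ _; rw [hN']
    rintro ⟨k, hk⟩
    apply hpM
    refine ⟨k, Nat.eq_of_mul_eq_mul_right hp'.pos ?_⟩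
    calc M * p = p ^ 2 * k := hk
      _ = p * k * p := by ring
  have hl' : atkinLehnerEigenvalueAt f' p =
      (((W.quadraticTwist (((-1 : ℤ) ^ (p / 2) * p : ℤ) : ℚ)).baseChange ℚ_[p]).localRootNumber ℤ_[p] : ℂ) := by
    rw [← localRootNumberAt_primesEquiv_symm_holds _ P]
    exact (W.quadraticTwist _).atkinLehnerEigenvalueAt_eq_localRootNumberAt_of_not_sq_dvd hf' P hPN' hPN'2
  rw [hl'] at h0
  exact_mod_cast h0

/-- **The ramified-twist sign law at an ODD `p`, BOTH SIGNS AT ONCE: `w(E)·w(E^{(p*d')}) = (−1/|d'|)·χ₄(p)·(d'/p)·W_p(E^{(p*)})`**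
for `E^{(p*)}` MULTIPLICATIVE at `p`, `N_E = M p²` (`p ∤ M`), `d' ≡ 1 (4)` squarefree prime to `N_E`, every prime of `M` split in
`ℚ(√(p* d'))`; assuming only the Modularity Theorem. Here `(−1/|d'|)·χ₄(p) = sign(p*d')`. The proof of
`ThreeFieldRoadSupply.rootNumber_mul_rootNumber_ramifiedTwist_of_multTwist` without its last (sign) step.
[cite: MurtyMurty1997, Ch. 6 §1] [cite: Rohrlich1993Compositio, Prop. 2(ii),(iii)] -/
theorem rootNumber_mul_rootNumber_ramifiedTwist_signFree_of_multTwist_odd (hmod : exists_isNewformOf) (hp2 : p ≠ 2)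
    {M : ℕ} (hN : W.conductorNorm ℤ = M * p ^ 2) (hpM : ¬ p ∣ M)
    (hmult : (W.quadraticTwist (((-1 : ℤ) ^ (p / 2) * p : ℤ) : ℚ)).HasMultiplicativeReductionAtPrime p)
    {d' : ℤ} (hd'4 : d' % 4 = 1) (hd'sq : Squarefree d') (hgcd : Int.gcd d' (W.conductorNorm ℤ) = 1)
    (hodd : ∀ q ∈ M.primeFactors, q ≠ 2 → J((-1 : ℤ) ^ (p / 2) * p * d' | q) = 1)
    (htwo : 2 ∣ M → ((-1 : ℤ) ^ (p / 2) * p * d') % 8 = 1) :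
    W.rootNumber * (W.quadraticTwist (((-1 : ℤ) ^ (p / 2) * p * d' : ℤ) : ℚ)).rootNumber =
      J(-1 | d'.natAbs) * ZMod.χ₄ p * legendreSym p d' *
        ((W.quadraticTwist (((-1 : ℤ) ^ (p / 2) * p : ℤ) : ℚ)).baseChange ℚ_[p]).localRootNumber ℤ_[p] := by
  -- adapted from `ThreeFieldRoadSupply.rootNumber_mul_rootNumber_ramifiedTwist_of_multTwist` (no sign step)
  have hp' : p.Prime := hp.out
  have hdZ0 : ((-1 : ℤ) ^ (p / 2) * p : ℤ) ≠ 0 :=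
    mul_ne_zero (pow_ne_zero _ (by norm_num)) (by exact_mod_cast hp'.ne_zero)
  have hd0 : (((((-1 : ℤ) ^ (p / 2) * p : ℤ)) : ℚ)) ≠ 0 := by exact_mod_cast hdZ0
  haveI hE' : (W.quadraticTwist (((-1 : ℤ) ^ (p / 2) * p : ℤ) : ℚ)).IsElliptic :=
    W.isElliptic_quadraticTwist hd0
  have hM0 : M ≠ 0 := by
    intro h; rw [h, zero_mul] at hN; exact (W.conductorNorm_pos_holds).ne' hN
  have hA := rootNumber_mul_rootNumber_pStarTwist_of_multTwist_odd W p hmod hp2 hN hpM hmult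
  have hN' := conductorNorm_pStarTwist_eq_mul_of_mult_odd W p hp2 hN hpM hmult
  have hgcd' : Int.gcd d' ((W.quadraticTwist (((-1 : ℤ) ^ (p / 2) * p : ℤ) : ℚ)).conductorNorm ℤ) = 1 := by
    rw [hN']
    have h1 := Int.isCoprime_iff_gcd_eq_one.mpr hgcd
    rw [hN] at h1
    push_cast at h1 ⊢
    rw [sq, ← mul_assoc] at h1
    exact Int.isCoprime_iff_gcd_eq_one.mp h1.of_mul_right_left
  have hB := ((W.quadraticTwist (((-1 : ℤ) ^ (p / 2) * p : ℤ) : ℚ)).rootNumber_quadraticTwist_of_emod_four_eq_one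
    hmod hd'4 hd'sq hgcd').1
  rw [quadraticTwist_quadraticTwist, hN'] at hB
  have hcast : ((((-1 : ℤ) ^ (p / 2) * p : ℤ) : ℚ)) * (d' : ℚ) = (((-1 : ℤ) ^ (p / 2) * p * d' : ℤ) : ℚ) := by
    push_cast; ring
  rw [hcast] at hB
  have hNe0 : NeZero d'.natAbs := ⟨Int.natAbs_ne_zero.mpr (by rintro rfl; norm_num at hd'4)⟩
  have hpodd : Odd p := (Nat.Prime.eq_two_or_odd' hp').resolve_left hp2
  have hJM : J(((M * p : ℕ) : ℤ) | d'.natAbs) = legendreSym p M * legendreSym p d' := by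
    rw [Nat.cast_mul, jacobiSym.mul_left, jacobiSym_natAbs_eq_legendreSym_of_split_anyLevel hp2 hd'4 hM0 hodd htwo,
      Literature.NumberTheory.QuadraticFields.jacobiSym_natAbs_eq_of_emod_four_eq_one hd'4 hpodd,
      ← jacobiSym.legendreSym.to_jacobiSym]
  have hM2 : legendreSym p M * legendreSym p M = 1 := by
    rw [← sq]
    refine legendreSym.sq_one p ?_
    rw [Int.cast_natCast, ne_eq, ZMod.natCast_eq_zero_iff]
    exact hpM
  set w' := ((W.quadraticTwist (((-1 : ℤ) ^ (p / 2) * p : ℤ) : ℚ)).baseChange ℚ_[p]).localRootNumber ℤ_[p]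
  calc W.rootNumber * (W.quadraticTwist (((-1 : ℤ) ^ (p / 2) * p * d' : ℤ) : ℚ)).rootNumber
      = J(-1 | d'.natAbs) * J(((M * p : ℕ) : ℤ) | d'.natAbs) *
          (W.rootNumber * (W.quadraticTwist (((-1 : ℤ) ^ (p / 2) * p : ℤ) : ℚ)).rootNumber) := by rw [hB]; ring
    _ = J(-1 | d'.natAbs) * (legendreSym p M * legendreSym p d') * (legendreSym p M * ZMod.χ₄ p * w') := by
        rw [hJM, hA]
    _ = J(-1 | d'.natAbs) * ZMod.χ₄ p * legendreSym p d' * w' := by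
        linear_combination (J(-1 | d'.natAbs) * ZMod.χ₄ p * legendreSym p d' * w') * hM2

/-- The data of the multiplicative twist model at an odd `p`: `N_W = M p²` (`p ∤ M`), `W^{(p*)}` multiplicative at `p`, and
`W^{(p*)}` split iff `V` split — for globally minimal `W`, `V` with `C • W^{(p*)} = V`, `V` multiplicative at `p`. [folklore] -/
theorem multTwist_data_of_pStarTwistModel [W.IsGloballyMinimal] (hp2 : p ≠ 2)
    (V : WeierstrassCurve ℚ) [V.IsElliptic] [V.IsGloballyMinimal] (C : VariableChange ℚ)
    (hV : C • W.quadraticTwist ((-1 : ℚ) ^ (p / 2) * p) = V) (hmultV : Mult V p) :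
    ∃ M : ℕ, W.conductorNorm ℤ = M * p ^ 2 ∧ ¬ p ∣ M ∧
      (W.quadraticTwist (((-1 : ℤ) ^ (p / 2) * p : ℤ) : ℚ)).HasMultiplicativeReductionAtPrime p ∧
      ((W.quadraticTwist (((-1 : ℤ) ^ (p / 2) * p : ℤ) : ℚ)).HasSplitMultiplicativeReductionAtPrime p ↔
        V.HasSplitMultiplicativeReductionAtPrime p) := by
  obtain ⟨M, hN, hpM⟩ := conductorNorm_eq_mul_sq_of_condExpTwo W p (condExpTwo_of_pStarTwistModel W p hp2 V C hV hmultV)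
  have hcast : ((((-1 : ℤ) ^ (p / 2) * p : ℤ)) : ℚ) = (-1 : ℚ) ^ (p / 2) * p := by push_cast; ring
  have hW' : W.quadraticTwist ((((-1 : ℤ) ^ (p / 2) * p : ℤ)) : ℚ) = C⁻¹ • V := by
    rw [hcast, ← hV, inv_smul_smul]
  refine ⟨M, hN, hpM, ?_, ?_⟩
  · rw [hW']; exact (hasMultiplicativeReductionAtPrime_smul_iff V _ p).mpr hmultV
  · rw [hW']; exact hasSplitMultiplicativeReductionAtPrime_smul_iff V _ p

/-- **The REAL ramified-twist sign law at an ODD additive potentially multiplicative `p`** (the `p = 3` corner of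
`rootNumber_mul_rootNumber_realRamifiedTwist_of_mult_model`): `W`, `V` globally minimal, `C • W^{(p*)} = V`, `V` MULTIPLICATIVE at `p`;
`d' ≡ 1 (4)` squarefree prime to `N_W`, `p* d' > 0`, every bad prime `ℓ ≠ p` of `W` split in `ℚ(√(p* d'))`. Then, assuming only the
Modularity Theorem, `w(W)·w(W^{(p* d')}) = +(d'/p)·W_p(V)`, `W_p(V) = −1` if `V` is split and `+1` if non-split (Rohrlich Prop. 2(ii)).
[cite: Rohrlich1993Compositio, Prop. 2(ii),(iii)] [cite: MurtyMurty1997, Ch. 6 §1] -/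
theorem rootNumber_mul_rootNumber_realRamifiedTwist_of_mult_model_odd [W.IsGloballyMinimal] (hmod : exists_isNewformOf)
    (hp2 : p ≠ 2) (V : WeierstrassCurve ℚ) [V.IsElliptic] [V.IsGloballyMinimal] (C : VariableChange ℚ)
    (hV : C • W.quadraticTwist ((-1 : ℚ) ^ (p / 2) * p) = V) (hmultV : V.HasMultiplicativeReductionAtPrime p)
    {d' : ℤ} (hd'4 : d' % 4 = 1) (hd'sq : Squarefree d') (hgcd : Int.gcd d' (W.conductorNorm ℤ) = 1)
    (hpos : 0 < (-1 : ℤ) ^ (p / 2) * p * d')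
    (hodd : ∀ ℓ : ℕ, ℓ.Prime → ℓ ∣ W.conductorNorm ℤ → ℓ ≠ p → ℓ ≠ 2 → J((-1 : ℤ) ^ (p / 2) * p * d' | ℓ) = 1)
    (htwo : 2 ∣ W.conductorNorm ℤ → ((-1 : ℤ) ^ (p / 2) * p * d') % 8 = 1) :
    W.rootNumber * (W.quadraticTwist (((-1 : ℤ) ^ (p / 2) * p * d' : ℤ) : ℚ)).rootNumber =
      legendreSym p d' * (if V.HasSplitMultiplicativeReductionAtPrime p then -1 else 1) := by
  obtain ⟨M, hN, hpM, hmult, hsplit_iff⟩ := multTwist_data_of_pStarTwistModel W p hp2 V C hV hmultV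
  have hM0 : M ≠ 0 := by
    intro h; rw [h, zero_mul] at hN; exact (W.conductorNorm_pos_holds).ne' hN
  have hodd' : ∀ q ∈ M.primeFactors, q ≠ 2 → J((-1 : ℤ) ^ (p / 2) * p * d' | q) = 1 := by
    intro q hq hq2
    obtain ⟨hqprime, hqM⟩ := Nat.mem_primeFactors_of_ne_zero hM0 |>.mp hq
    have hqp : q ≠ p := by rintro rfl; exact hpM hqM
    exact hodd q hqprime (by rw [hN]; exact hqM.mul_right _) hqp hq2
  have htwo' : 2 ∣ M → ((-1 : ℤ) ^ (p / 2) * p * d') % 8 = 1 := fun h2 ↦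
    htwo (by rw [hN]; exact h2.mul_right _)
  rw [rootNumber_mul_rootNumber_ramifiedTwist_signFree_of_multTwist_odd W p hmod hp2 hN hpM hmult hd'4 hd'sq hgcd hodd' htwo',
    jacobiSym_neg_one_natAbs_eq_of_pos p hp2 hd'4 hpos]
  have hχ₄ := χ₄_mul_self_of_ne_two (p := p) hp2
  have hw' : ((W.quadraticTwist (((-1 : ℤ) ^ (p / 2) * p : ℤ) : ℚ)).baseChange ℚ_[p]).localRootNumber ℤ_[p] =
      (if V.HasSplitMultiplicativeReductionAtPrime p then -1 else 1) := by
    by_cases hs : V.HasSplitMultiplicativeReductionAtPrime p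
    · rw [if_pos hs]
      exact localRootNumber_of_hasSplitMultiplicativeReduction ℤ_[p] _ (hsplit_iff.mpr hs)
    · rw [if_neg hs]
      exact localRootNumber_of_hasMultiplicativeReduction ℤ_[p] _ hmult (fun h ↦ hs (hsplit_iff.mp h))
  rw [hw']
  linear_combination (legendreSym p d' * (if V.HasSplitMultiplicativeReductionAtPrime p then (-1 : ℤ) else 1)) * hχ₄

/-- **The (imaginary) ramified-twist sign law at an ODD additive potentially multiplicative `p`** (the `p = 3` corner of
`ThreeFieldRoadSupply.rootNumber_mul_rootNumber_ramifiedTwist_of_mult_model`, in the `C • W^{(p*)} = V` orientation): as the previous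
theorem with `p* d' < 0`, conclusion `w(W)·w(W^{(p* d')}) = −(d'/p)·W_p(V)`.
[cite: Rohrlich1993Compositio, Prop. 2(ii),(iii)] [cite: MurtyMurty1997, Ch. 6 §1] -/
theorem rootNumber_mul_rootNumber_ramifiedTwist_of_mult_model_odd [W.IsGloballyMinimal] (hmod : exists_isNewformOf)
    (hp2 : p ≠ 2) (V : WeierstrassCurve ℚ) [V.IsElliptic] [V.IsGloballyMinimal] (C : VariableChange ℚ)
    (hV : C • W.quadraticTwist ((-1 : ℚ) ^ (p / 2) * p) = V) (hmultV : V.HasMultiplicativeReductionAtPrime p)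
    {d' : ℤ} (hd'4 : d' % 4 = 1) (hd'sq : Squarefree d') (hgcd : Int.gcd d' (W.conductorNorm ℤ) = 1)
    (hneg : (-1 : ℤ) ^ (p / 2) * p * d' < 0)
    (hodd : ∀ ℓ : ℕ, ℓ.Prime → ℓ ∣ W.conductorNorm ℤ → ℓ ≠ p → ℓ ≠ 2 → J((-1 : ℤ) ^ (p / 2) * p * d' | ℓ) = 1)
    (htwo : 2 ∣ W.conductorNorm ℤ → ((-1 : ℤ) ^ (p / 2) * p * d') % 8 = 1) :
    W.rootNumber * (W.quadraticTwist (((-1 : ℤ) ^ (p / 2) * p * d' : ℤ) : ℚ)).rootNumber =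
      -legendreSym p d' * (if V.HasSplitMultiplicativeReductionAtPrime p then -1 else 1) := by
  obtain ⟨M, hN, hpM, hmult, hsplit_iff⟩ := multTwist_data_of_pStarTwistModel W p hp2 V C hV hmultV
  have hM0 : M ≠ 0 := by
    intro h; rw [h, zero_mul] at hN; exact (W.conductorNorm_pos_holds).ne' hN
  have hodd' : ∀ q ∈ M.primeFactors, q ≠ 2 → J((-1 : ℤ) ^ (p / 2) * p * d' | q) = 1 := by
    intro q hq hq2
    obtain ⟨hqprime, hqM⟩ := Nat.mem_primeFactors_of_ne_zero hM0 |>.mp hq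
    have hqp : q ≠ p := by rintro rfl; exact hpM hqM
    exact hodd q hqprime (by rw [hN]; exact hqM.mul_right _) hqp hq2
  have htwo' : 2 ∣ M → ((-1 : ℤ) ^ (p / 2) * p * d') % 8 = 1 := fun h2 ↦
    htwo (by rw [hN]; exact h2.mul_right _)
  rw [rootNumber_mul_rootNumber_ramifiedTwist_signFree_of_multTwist_odd W p hmod hp2 hN hpM hmult hd'4 hd'sq hgcd hodd' htwo',
    jacobiSym_neg_one_natAbs_eq_of_neg hp2 hd'4 hneg]
  have hχ₄ := χ₄_mul_self_of_ne_two (p := p) hp2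
  have hw' : ((W.quadraticTwist (((-1 : ℤ) ^ (p / 2) * p : ℤ) : ℚ)).baseChange ℚ_[p]).localRootNumber ℤ_[p] =
      (if V.HasSplitMultiplicativeReductionAtPrime p then -1 else 1) := by
    by_cases hs : V.HasSplitMultiplicativeReductionAtPrime p
    · rw [if_pos hs]
      exact localRootNumber_of_hasSplitMultiplicativeReduction ℤ_[p] _ (hsplit_iff.mpr hs)
    · rw [if_neg hs]
      exact localRootNumber_of_hasMultiplicativeReduction ℤ_[p] _ hmult (fun h ↦ hs (hsplit_iff.mp h))
  rw [hw']
  linear_combination (-(legendreSym p d' * (if V.HasSplitMultiplicativeReductionAtPrime p then (-1 : ℤ) else 1))) * hχ₄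

end SignOdd

end Summit.BirchSwinnertonDyer.BirchSwinnertonDyer.Theorems.EulerHalfGenusSupply

end
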